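/-
Origin: expansion seat `planner-pub-hodgecm-toy-g2-0`, handover #30 v2 2026-08-18T09:59:39Z (`HOME/pub-hodgecm-toy-g2/lean/ToyG2/RadicalProd.lean`, md5 08992f7f, 352 lines);
landed by the gen-7 packager in gate run 28 as `HodgeCM/Model/ToyG2/RadicalProd.lean` (verbatim).
-/
/-
# HodgeCM.Model.ToyG2.RadicalProd — G1 by induction over shapes: the generalised radical statement and its reduction
to a single product step

Generation 2 of the `pub-hodgecm-toy` lineage (seat `planner-pub-hodgecm-toy-g2-0`), DESIGN.md §9·UPDATE 09:25Z (G1′).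

`RadKilled S X f` (the surface trace of an admissible pull-back kills the left radical of the target's degree-4 pairing)
is proved for ALL good targets `X` from two steps, by induction over the shape of `X`:
* the statement is generalised to `GenRadKilled S X`: for every admissible `ψ : H¹X → H¹S`, all degrees `i + j = 2 dim X`,
  and every `z ∈ ⋀^k H¹S`, the functional `y ↦ tr_S(ψ^* y ∧ z)` kills `leftRad X i j` (`radKilled_of_genRadKilled`);
* `genRadKilled_of_isBlockFree` (atoms, the empty object: the radical is trivial), `genBlockStep` (**proved here**: a single
  good Picard block as target, via block-admissibility, the linear equivalence `inclAt u' : H¹P' ≃ H¹S` for a surface `S`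
  carrying a block — `incl_injective`, `incl_surjective_of_isPB` — and Lemma L1 `trOf_comp_inclAt`);
* the PRODUCT STEP `GenProdStep` (`GenRadKilled S X₁ → GenRadKilled S X₂ → GenRadKilled S (X₁ × X₂)`) is the one remaining
  hypothesis: `toyUniverse₃_modelAxioms_of_prodStep : GenProdStep → (∀ X good, HodgeRiesz X) → ModelAxioms` (28/28).
  Its proof is pure linear algebra over the factor pairings — the tensor radical lemma `sum_eq_zero_of_pairings`
  (`TensorRadical`), the Künneth trace formula `trOf_wedge_kun_kun` and graded commutativity (`GradedComm`), see DESIGN.md §9.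
The same shape induction reduces Hodge–Riesz (`HodgeRiesz`, G3) to `HRProdStep` from `hodgeRiesz_of_isBlockFree` and
`hodgeRiesz_pbObj`; hence `toyUniverse₃_modelAxioms_of_prodSteps : GenProdStep → HRProdStep → ModelAxioms` (28/28 from
two purely algebraic product statements about the toy category).
Also: `trOf_wedge_assoc`, `trOf_wedge_comm` (associativity / graded symmetry of the trace pairing).
-/
import Mathlib
import Summits.HodgeConjecture.HodgeCM.Model.ToyG2.GradedComm

namespace HodgeCM.ToyG2

open HodgeCM.Toy HodgeCM.Toy.CMPresentation
open Literature.AlgebraicGeometry.Motives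
open scoped TensorProduct
open exteriorPower Obj₂

noncomputable section

/-! ### §1 Associativity and graded symmetry of the trace pairing -/

/-- (Ported verbatim from the HodgeCMPerL package; no docstring in the source.) -/
theorem trOf_wedge_assoc (X : Obj₂) {i j k : ℕ} (x : ⋀[ℚ]^i X.L) (y : ⋀[ℚ]^j X.L) (z : ⋀[ℚ]^k X.L) :
    trOf X (i + j + k) (wedge ℚ X.L (i + j) k (wedge ℚ X.L i j x y) z)
      = trOf X (i + (j + k)) (wedge ℚ X.L i (j + k) x (wedge ℚ X.L j k y z)) :=
  trOf_congr X (add_assoc i j k) (by simp only [wedge_coe, mul_assoc])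

/-- (Ported verbatim from the HodgeCMPerL package; no docstring in the source.) -/
theorem trOf_wedge_comm (X : Obj₂) {j p : ℕ} (x : ⋀[ℚ]^j X.L) (y : ⋀[ℚ]^p X.L) :
    trOf X (j + p) (wedge ℚ X.L j p x y) = (-1 : ℚ) ^ (j * p) * trOf X (p + j) (wedge ℚ X.L p j y x) := by
  rw [trOf_congr X (add_comm j p) (z' := ((-1 : ℚ) ^ (j * p)) • wedge ℚ X.L p j y x)
      (by rw [wedge_coe, Submodule.coe_smul, wedge_coe]; exact mul_comm_graded x.2 y.2),
    map_smul, smul_eq_mul]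

/-! ### §2 The generalised statement -/

/-- **generalised radical killing**: for every admissible `ψ : H¹X → H¹S`, all complementary degrees `i + j = 2 dim X` and every
`z ∈ ⋀^k H¹S`, the functional `y ↦ tr_S(ψ^* y ∧ z)` on `⋀^i H¹X` kills the left radical `leftRad X i j` -/
def GenRadKilled (S X : Obj₂) : Prop :=
  ∀ (i j : ℕ), i + j = sdeg X.s X.leaf → ∀ (ψ : X.L →ₗ[ℚ] S.L), Adm S X ψ →
    ∀ (k : ℕ) (z : ⋀[ℚ]^k S.L), ∀ y ∈ leftRad X i j,
      trOf S (i + k) (wedge ℚ S.L i k (map i ψ y) z) = 0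

/-- block-free targets (in particular atoms and the empty object): the radical is trivial -/
theorem genRadKilled_of_isBlockFree {S X : Obj₂} (hX : X.IsBlockFree) : GenRadKilled S X := by
  intro i j hij ψ _ k z y hy
  rw [leftRad_eq_bot_of_isBlockFree hX (hij.trans (sdeg_eq X)), Submodule.mem_bot] at hy
  rw [hy, map_zero, map_zero, LinearMap.zero_apply, map_zero]

/-- in degree `0` the left radical of a good object is trivial -/
theorem eq_zero_of_mem_leftRad_zero {X : Obj₂} (hX : X.Good) {j : ℕ} (hj : j = sdeg X.s X.leaf)
    {y : ⋀[ℚ]^0 X.L} (hy : y ∈ leftRad X 0 j) : y = 0 := by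
  obtain ⟨r, rfl⟩ := exists_eq_smul_one0 y
  have hne : trOf X j ≠ 0 := by rw [hj]; exact trOf_sdeg_ne_zero hX
  obtain ⟨c, hc⟩ : ∃ c, trOf X j c ≠ 0 := by
    by_contra h
    exact hne (LinearMap.ext fun c => not_ne_iff.1 (not_exists.1 h c))
  have h := (mem_leftRad.1 hy) c
  rw [map_smul, LinearMap.smul_apply, map_smul, smul_eq_mul,
    trOf_congr X (zero_add j) (z := wedge ℚ X.L 0 j (one0 ℚ X.L) c) (z' := c)
      (by rw [wedge_coe, one0_coe, one_mul])] at h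
  rcases mul_eq_zero.1 h with hr | hc'
  · rw [hr, zero_smul]
  · exact absurd hc' hc

/-- `⋀^n` of the zero map vanishes for `n > 0` -/
lemma extMap_zero_of_pos (M N : Type*) [AddCommGroup M] [Module ℚ M] [AddCommGroup N] [Module ℚ N]
    {n : ℕ} (hn : 0 < n) : map n (0 : M →ₗ[ℚ] N) = 0 := by
  refine exteriorPower.linearMap_ext (AlternatingMap.ext fun v => ?_)
  rw [LinearMap.compAlternatingMap_apply, LinearMap.compAlternatingMap_apply, map_apply_ιMulti,
    LinearMap.zero_apply]
  exact (ιMulti ℚ n).map_coord_zero ⟨0, hn⟩ rfl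

/-! ### §3 `RadKilled` from the generalised statement -/

/-- (Ported verbatim from the HodgeCMPerL package; no docstring in the source.) -/
theorem radKilled_of_genRadKilled {S X : Obj₂} (h : GenRadKilled S X) (f : Hom₂ S X) : RadKilled S X f := by
  intro y hy
  by_cases h2 : 2 ≤ X.dim
  · have hij : 4 + 2 * (X.dim - 2) = sdeg X.s X.leaf := by rw [sdeg_eq]; omega
    have h0 := h 4 (2 * (X.dim - 2)) hij f.lin f.adm 0 (one0 ℚ S.L) y hy
    rwa [wedge_one0] at h0
  · have hbf : X.IsBlockFree := by
      intro u hu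
      have h4 := four_le_sdeg_of_isPB X.s X.leaf u hu
      rw [sdeg_eq] at h4
      omega
    exact radKilled_of_isBlockFree hbf f y hy

/-! ### §4 The two steps -/

/-- the block step: a single good Picard block as target -/
def GenBlockStep : Prop :=
  ∀ (S : Obj₂) (p : PLeaf), S.Good → S.dim = 2 → (Leaf.pb p).Good → GenRadKilled S (pbObj p)

/-- **the product step** (generation 3): generalised radical killing passes to binary products of good objects -/
def GenProdStep : Prop :=
  ∀ (S X₁ X₂ : Obj₂), S.Good → S.dim = 2 → X₁.Good → X₂.Good →
    GenRadKilled S X₁ → GenRadKilled S X₂ → GenRadKilled S (X₁.prod X₂)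

/-- shape induction -/
theorem genRadKilled_of_steps (hb : GenBlockStep) (hp : GenProdStep) {S : Obj₂} (hS : S.Good) (hS2 : S.dim = 2) :
    ∀ (s : Shape) (l : s.toType → Leaf), Obj₂.Good ⟨s, l⟩ → GenRadKilled S ⟨s, l⟩ := by
  intro s
  induction s with
  | empty => intro l _; exact genRadKilled_of_isBlockFree (fun u => u.elim)
  | unit =>
    intro l hl
    have hfun : l = fun _ => l () := funext fun u => rfl
    cases hlu : l () with
    | atom a =>
      refine genRadKilled_of_isBlockFree (fun u hu => ?_)
      change (l u).IsPB at hu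
      rw [show l u = l () from rfl, hlu] at hu
      exact hu
    | pb p =>
      have hX : (⟨.unit, l⟩ : Obj₂) = pbObj p := by rw [hfun, hlu]
      rw [hX]
      have hgood : (Leaf.pb p).Good := by
        have := hl ()
        change (l ()).Good at this
        rwa [hlu] at this
      exact hb S p hS hS2 hgood
  | sum a b iha ihb =>
    intro l hl
    have hX : (⟨.sum a b, l⟩ : Obj₂)
        = Obj₂.prod ⟨a, fun u => l (Sum.inl u)⟩ ⟨b, fun u => l (Sum.inr u)⟩ := by
      change (⟨.sum a b, l⟩ : Obj₂)
        = ⟨a.sum b, Shape.sumElim (fun u => l (Sum.inl u)) (fun u => l (Sum.inr u))⟩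
      congr 1
      funext u
      rcases u with u | u <;> rfl
    rw [hX]
    exact hp S _ _ hS hS2 (fun u => hl (Sum.inl u)) (fun u => hl (Sum.inr u))
      (iha _ fun u => hl (Sum.inl u)) (ihb _ fun u => hl (Sum.inr u))

/-- (Ported verbatim from the HodgeCMPerL package; no docstring in the source.) -/
theorem radKilled_of_steps (hb : GenBlockStep) (hp : GenProdStep) :
    ∀ (S X : Obj₂) (f : Hom₂ S X), S.Good → X.Good → S.dim = 2 → RadKilled S X f :=
  fun _ X f hS hX hS2 => radKilled_of_genRadKilled (genRadKilled_of_steps hb hp hS hS2 X.s X.leaf hX) f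

/-! ### §5 The block step -/

/-- (Ported verbatim from the HodgeCMPerL package; no docstring in the source.) -/
theorem incl_injective : ∀ (s : Shape) (l : s.toType → Leaf) (u : s.toType),
    Function.Injective (incl s l u) := by
  intro s
  induction s with
  | empty => intro l u; exact u.elim
  | unit => intro l u x y h; exact h
  | sum a b iha ihb =>
    intro l u
    rcases u with u | u
    · intro x y h
      apply iha (fun v => l (Sum.inl v)) u
      have h' := congrArg (fstL (Obj₂.expand a fun v => l (Sum.inl v)) (Obj₂.expand b fun v => l (Sum.inr v))) h
      change fstL _ _ (Obj.inlL _ _ (incl a (fun v => l (Sum.inl v)) u x))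
        = fstL _ _ (Obj.inlL _ _ (incl a (fun v => l (Sum.inl v)) u y)) at h'
      rwa [fstL_inlL, fstL_inlL] at h'
    · intro x y h
      apply ihb (fun v => l (Sum.inr v)) u
      have h' := congrArg (sndL (Obj₂.expand a fun v => l (Sum.inl v)) (Obj₂.expand b fun v => l (Sum.inr v))) h
      change sndL _ _ (Obj.inrL _ _ (incl b (fun v => l (Sum.inr v)) u x))
        = sndL _ _ (Obj.inrL _ _ (incl b (fun v => l (Sum.inr v)) u y)) at h'
      rwa [sndL_inrL, sndL_inrL] at h'

/-- an object of structural degree `0` has trivial `H¹` -/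
theorem subsingleton_L_of_sdeg_eq_zero (X : Obj₂) (h : sdeg X.s X.leaf = 0) : Subsingleton X.L := by
  have hbf : X.IsBlockFree := fun u hu => by
    have := four_le_sdeg_of_isPB X.s X.leaf u hu
    omega
  have h0 : Module.finrank ℚ X.L = 0 := by rw [← two_mul_dim_eq_finrank hbf, ← sdeg_eq, h]
  exact Module.finrank_zero_iff.1 h0

/-- for an object of structural degree `4` (a surface) the inclusion of a block leaf is onto `H¹` -/
theorem incl_surjective_of_isPB : ∀ (s : Shape) (l : s.toType → Leaf) (u : s.toType),
    (l u).IsPB → sdeg s l = 4 → Function.Surjective (incl s l u) := by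
  intro s
  induction s with
  | empty => intro l u; exact u.elim
  | unit => intro l u _ _ x; exact ⟨x, rfl⟩
  | sum a b iha ihb =>
    intro l u hu h4
    have h4' : sdeg a (fun v => l (Sum.inl v)) + sdeg b (fun v => l (Sum.inr v)) = 4 := h4
    rcases u with u | u
    · have ha := four_le_sdeg_of_isPB a (fun v => l (Sum.inl v)) u hu
      have hb0 : sdeg b (fun v => l (Sum.inr v)) = 0 := by omega
      haveI := subsingleton_L_of_sdeg_eq_zero ⟨b, fun v => l (Sum.inr v)⟩ hb0
      intro x
      obtain ⟨w, hw⟩ := iha (fun v => l (Sum.inl v)) u hu (by omega)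
        (fstL (Obj₂.expand a fun v => l (Sum.inl v)) (Obj₂.expand b fun v => l (Sum.inr v)) x)
      refine ⟨w, ?_⟩
      change Obj.inlL _ _ (incl a (fun v => l (Sum.inl v)) u w) = x
      rw [hw]
      conv_rhs => rw [← inlL_fstL_add_inrL_sndL _ _ x]
      rw [Subsingleton.elim (sndL _ _ x) 0, map_zero, add_zero]
    · have hb := four_le_sdeg_of_isPB b (fun v => l (Sum.inr v)) u hu
      have ha0 : sdeg a (fun v => l (Sum.inl v)) = 0 := by omega
      haveI := subsingleton_L_of_sdeg_eq_zero ⟨a, fun v => l (Sum.inl v)⟩ ha0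
      intro x
      obtain ⟨w, hw⟩ := ihb (fun v => l (Sum.inr v)) u hu (by omega)
        (sndL (Obj₂.expand a fun v => l (Sum.inl v)) (Obj₂.expand b fun v => l (Sum.inr v)) x)
      refine ⟨w, ?_⟩
      change Obj.inrL _ _ (incl b (fun v => l (Sum.inr v)) u w) = x
      rw [hw]
      conv_rhs => rw [← inlL_fstL_add_inrL_sndL _ _ x]
      rw [Subsingleton.elim (fstL _ _ x) 0, map_zero, zero_add]

/-- the last step of the block case, in syntactic degree `4` -/
theorem blockFinish (S : Obj₂) (u' : S.s.toType) (hu' : (S.leaf u').IsPB) (h4S : sdeg S.s S.leaf = 4) (p : PLeaf)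
    (g : (pbObj p).L ≃ₗ[ℚ] (S.leaf u').obj.L)
    (ht : (S.leaf u').trace4 ∘ₗ map 4 g.toLinearMap = p.ℓ)
    (w : ⋀[ℚ]^4 (pbObj p).L) (hw : trOf (pbObj p) 4 w = 0) :
    trOf S 4 (map 4 (S.inclAt u') (map 4 g.toLinearMap w)) = 0 := by
  obtain ⟨c₀, hc₀⟩ := trOf_comp_inclAt S u' hu' h4S
  have e1 := LinearMap.congr_fun hc₀ (map 4 g.toLinearMap w)
  have e2 := LinearMap.congr_fun ht w
  simp only [LinearMap.comp_apply, LinearMap.smul_apply] at e1 e2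
  rw [e1, e2, smul_eq_mul]
  rw [trOf_pbObj] at hw
  exact mul_eq_zero_of_right c₀ hw

set_option maxHeartbeats 1600000 in
/-- **the block step holds**: generalised radical killing for a single good Picard block as target -/
theorem genBlockStep : GenBlockStep := by
  intro S p hS hS2 hp i j hij ψ hψ k z y hy
  have h4S : sdeg S.s S.leaf = 4 := by rw [sdeg_eq, hS2]
  have hij4 : i + j = 4 := hij
  rcases Nat.eq_zero_or_pos i with hi | hi
  · subst hi
    have hy0 := eq_zero_of_mem_leftRad_zero (good_pbObj hp) ((zero_add j).symm.trans hij) hy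
    rw [hy0, map_zero, map_zero, LinearMap.zero_apply, map_zero]
  rcases hψ () trivial with h0 | ⟨u', hu', g, hg, ht⟩
  · have hψ0 : ψ = 0 := (LinearMap.comp_id _).symm.trans h0
    rw [hψ0, extMap_zero_of_pos _ _ hi, LinearMap.zero_apply, map_zero, LinearMap.zero_apply, map_zero]
  by_cases hik : i + k = 4
  swap
  · rw [trOf_of_ne (by rw [h4S]; exact fun h => hik h.symm), LinearMap.zero_apply]
  have hkj : k = j := by omega
  subst hkj
  -- retype the block isomorphism on `H¹(pbObj p)` (syntactically), keeping the two admissibility relations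
  obtain ⟨g', hψ', ht'⟩ : ∃ g' : (pbObj p).L ≃ₗ[ℚ] (S.leaf u').obj.L,
      ψ = S.inclAt u' ∘ₗ g'.toLinearMap ∧ (S.leaf u').trace4 ∘ₗ map 4 g'.toLinearMap = p.ℓ :=
    ⟨g, (LinearMap.comp_id _).symm.trans hg, ht⟩
  clear hg ht g
  -- `ψ` is a linear equivalence: write `z = ψ^* c`
  have hcoe : ⇑ψ = ⇑(S.inclAt u') ∘ ⇑g'.toLinearMap := by rw [hψ', LinearMap.coe_comp]
  have hinj : Function.Injective ψ := by
    rw [hcoe]; exact (incl_injective S.s S.leaf u').comp g'.injective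
  have hsurj : Function.Surjective ψ := by
    rw [hcoe]; exact (incl_surjective_of_isPB S.s S.leaf u' hu' h4S).comp g'.surjective
  obtain ⟨e, he0⟩ : ∃ e : (pbObj p).L ≃ₗ[ℚ] S.L, ∀ x, e x = ψ x :=
    ⟨LinearEquiv.ofBijective ψ ⟨hinj, hsurj⟩, fun x => by simp⟩
  have he : ψ ∘ₗ e.symm.toLinearMap = LinearMap.id :=
    LinearMap.ext fun x => by
      change ψ (e.symm x) = x
      rw [← he0, e.apply_symm_apply]
  obtain ⟨c, rfl⟩ : ∃ c, z = map k ψ c :=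
    ⟨map k e.symm.toLinearMap z, by
      change z = (map k ψ ∘ₗ map k e.symm.toLinearMap) z
      rw [← map_comp, he, map_id]; rfl⟩
  have hV : trOf (pbObj p) (i + k) (wedge ℚ (pbObj p).L i k y c) = 0 := (mem_leftRad.1 hy) c
  have hfold : wedge ℚ S.L i k (map i ψ y) (map k ψ c) = map (i + k) ψ (wedge ℚ (pbObj p).L i k y c) :=
    (map_wedge i k ψ y c).symm
  rw [hfold]
  -- transport from degree `i + k` to the syntactic degree `4`
  set W := wedge ℚ (pbObj p).L i k y c with hW
  have hW4 : (W : ExteriorAlgebra ℚ (pbObj p).L) ∈ ⋀[ℚ]^4 (pbObj p).L := by rw [← hik]; exact W.2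
  have hV4 : trOf (pbObj p) 4 ⟨W, hW4⟩ = 0 := by
    rw [← trOf_congr (pbObj p) hik (z := W) (z' := ⟨W, hW4⟩) rfl]
    exact hV
  have hmap : map 4 ψ = map 4 (S.inclAt u') ∘ₗ map 4 g'.toLinearMap := by
    rw [hψ']; exact map_comp _ _
  rw [trOf_congr S hik (z := map (i + k) ψ W) (z' := map 4 ψ ⟨W, hW4⟩) (by simp only [coe_map]),
    LinearMap.congr_fun hmap ⟨W, hW4⟩]
  exact blockFinish S u' hu' h4S p g' ht' _ hV4

/-! ### §6 28/28 from the product step and Hodge–Riesz -/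

/-- (Ported verbatim from the HodgeCMPerL package; no docstring in the source.) -/
theorem radKilled_of_prodStep (hp : GenProdStep) :
    ∀ (S X : Obj₂) (f : Hom₂ S X), S.Good → X.Good → S.dim = 2 → RadKilled S X f :=
  radKilled_of_steps genBlockStep hp

/-- **28/28 reduced to the product step and Hodge–Riesz** -/
theorem toyUniverse₃_modelAxioms_of_prodStep (d t : ℚ) (hp : GenProdStep)
    (h2 : ∀ X : Obj₂, X.Good → HodgeRiesz X) : (toyUniverse₃ d t).ModelAxioms :=
  toyUniverse₃_modelAxioms_of' d t (radKilled_of_prodStep hp) h2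

/-! ### §7 The same shape induction for Hodge–Riesz: 28/28 from two product statements -/

/-- **the Hodge–Riesz product step** (generation 3): Hodge–Riesz representability passes to binary products of
good objects -/
def HRProdStep : Prop :=
  ∀ (X₁ X₂ : Obj₂), X₁.Good → X₂.Good → HodgeRiesz X₁ → HodgeRiesz X₂ → HodgeRiesz (X₁.prod X₂)

/-- shape induction for Hodge–Riesz: block-free objects (`hodgeRiesz_of_isBlockFree`) and the period surface
(`hodgeRiesz_pbObj`) are the base cases -/
theorem hodgeRiesz_of_prodStep (hp : HRProdStep) :
    ∀ (s : Shape) (l : s.toType → Leaf), Obj₂.Good ⟨s, l⟩ → HodgeRiesz ⟨s, l⟩ := by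
  intro s
  induction s with
  | empty => intro l _; exact hodgeRiesz_of_isBlockFree (fun u => u.elim)
  | unit =>
    intro l hl
    have hfun : l = fun _ => l () := funext fun u => rfl
    cases hlu : l () with
    | atom a =>
      refine hodgeRiesz_of_isBlockFree (fun u hu => ?_)
      change (l u).IsPB at hu
      rw [show l u = l () from rfl, hlu] at hu
      exact hu
    | pb p =>
      have hX : (⟨.unit, l⟩ : Obj₂) = pbObj p := by rw [hfun, hlu]
      rw [hX]
      have hgood : (Leaf.pb p).Good := by
        have := hl ()
        change (l ()).Good at this
        rwa [hlu] at this
      exact hodgeRiesz_pbObj hgood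
  | sum a b iha ihb =>
    intro l hl
    have hX : (⟨.sum a b, l⟩ : Obj₂)
        = Obj₂.prod ⟨a, fun u => l (Sum.inl u)⟩ ⟨b, fun u => l (Sum.inr u)⟩ := by
      change (⟨.sum a b, l⟩ : Obj₂)
        = ⟨a.sum b, Shape.sumElim (fun u => l (Sum.inl u)) (fun u => l (Sum.inr u))⟩
      congr 1
      funext u
      rcases u with u | u <;> rfl
    rw [hX]
    exact hp _ _ (fun u => hl (Sum.inl u)) (fun u => hl (Sum.inr u))
      (iha _ fun u => hl (Sum.inl u)) (ihb _ fun u => hl (Sum.inr u))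

/-- **28/28 for `toyUniverse₃ d t` from the two product statements** `GenProdStep` (radicals) and `HRProdStep`
(Hodge–Riesz): every other ingredient — the 27 fields, the reduction of M26 to `RadKilled` + `HodgeRiesz`, the block-free
and single-block cases, the shape inductions — is kernel-proved in this package. -/
theorem toyUniverse₃_modelAxioms_of_prodSteps (d t : ℚ) (h1 : GenProdStep) (h2 : HRProdStep) :
    (toyUniverse₃ d t).ModelAxioms :=
  toyUniverse₃_modelAxioms_of_prodStep d t h1 (fun X hX => hodgeRiesz_of_prodStep h2 X.s X.leaf hX)

end

end HodgeCM.ToyG2
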